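import Summits.QuantumFields.BalabanUV.T4Continuum.Spine.NE1p.DressedSmallFieldTBoxMixedLetterSourceCommute

/-!
# T⁴ programme, spine estimate NE1′ (node O3b/H2) — THE SOURCE EXPANSION OF THE (1.23)∕(2.14) LETTER: for `E(μ; t_□, σ)` jointly analytic
# in the source `|μ| < μ₁` and the contour variables, `(1.23)(E(μ)) = Σ_k μ^k∕k! · (1.23)(∂^k E∕∂μ^k(0))` on the WHOLE source disc — the Taylor
# coefficients of the letter ARE the letters of the Taylor coefficients of the factor; Cauchy's estimate at every order on the strict
# sub-window (`k!·B∕(μ₁′ − μ₀)^k`, both routes); the Taylor REMAINDER after `K` terms costs `B·(|μ|∕μ₁′)^K∕(1 − |μ|∕μ₁′)`, `K = 1` = the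
# regenerated part is linear in the source

Cell `pub-balaban`, sub-cell `t4`, row NE1′ formalisation crew (`t4/formal/NE1p/LEAVES.md` row W⟨next⟩ — own-initiative DICTIONARY follower of
the unit's «SourceCommute» row (`∂^k_μ` commutes into the letter), W98 «THE THIRD RADIUS» (p244458) and W93 (p244127) under typer R-T61 (ii)),
unit `b2b-balaban-t4-ne1p-formalise-leaf-08` (gen 14).  ADDITIVE — imports `Spine/NE1p/DressedSmallFieldTBoxMixedLetterSourceCommute` ONLY
(`iteratedDeriv_tBoxMixedLetter_source`, `norm_iteratedDeriv_tBoxMixedLetter_source_le`, `cons_mem_polyBall`; → W98 `differentiableOn_letter_source`;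
W93 `analyticOnNhd_section`; W89 `norm_tBoxMixedLetter_le`; W39.1 `μS`∕`wS`∕`σS`; the NE5 substrate's `w₁`∕`circ`; the template's `polydisc` — BY
NAME) + Mathlib (`Complex.hasSum_taylorSeries_on_ball`, `Complex.norm_iteratedDeriv_le_of_forall_mem_sphere_norm_le`, `hasSum_nat_add_iff'`,
`hasSum_geometric_of_lt_one`, `tsum_of_norm_bounded`).  THEOREMS ONLY + `example`s; 0 `def`, 0 `instance`, 0 `def … : Prop`, 0 cite, 0 sorry,
0 `attribute`; nothing upstream restated.

WHY THIS FILE.  The lineage now knows that `μ ↦ (1.23)(E(μ))` is holomorphic on the source disc (W93∕W98) and that every source derivative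
commutes into the letter («SourceCommute»).  The cell's (w5)∕(w5b)∕(w6) currencies (trigger notes (n1)–(n5), CELL records: the μ-extension and
its «termwise» expansion in the observable source are the cell's, not print's) read a dressed term as «value at μ = 0» + «regenerated part»,
the latter expanded or bounded in powers of the source inside a strict sub-window.  At the LETTER object this is one-variable Cauchy theory:
* §1 **`hasSum_tBoxMixedLetter_source`∕`tBoxMixedLetter_eq_tsum_source`**: for `E` jointly analytic on `{|μ| < μ₁} × {|t| < R₀} × Π_j{|σ_j| <
  R_{j+1}}`, `0 < ρ < R₀`, `1 < r_j < R_{j+1}` and `|μ| < μ₁`, the Taylor series of the letter at `0` converges to the letter on the WHOLE disc and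
  its `k`-th coefficient is `(k!)⁻¹ · (1.23)(∂^k E∕∂μ^k(0))` (Mathlib `Complex.hasSum_taylorSeries_on_ball` + «SourceCommute» §3 at `μ = 0`);
* §2 [folklore] **`norm_iteratedDeriv_le_of_strict_window`**: Cauchy's estimate at order `k` on a disc strictly inside the disc of analyticity
  (`‖f^{(k)}(μ)‖ ≤ k!·B∕(μ₁′ − μ₀)^k` for `|μ| ≤ μ₀ < μ₁′ < μ₁`, `‖f‖ ≤ B` on `|z| ≤ μ₁′`; W98 §1 is `k = 1`); **`norm_iteratedDeriv_letter_source_le`**: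
  applied to the letter with W89's `B = ρ⁻¹·A·e^{−(κ₁−1)·#S}` — `‖∂^k_μ (1.23)(μ)‖ ≤ k!·ρ⁻¹·(A·e^{−(κ₁−1)·#S})∕(μ₁′ − μ₀)^k`;
* §3 **`norm_iteratedDeriv_source_le_of_strict_window`**: the same estimate on the FACTOR, `‖∂^k E∕∂μ^k(μ; v)‖ ≤ k!·A∕(μ₁′ − μ₀)^k` — the currency
  `A_k` of «SourceCommute» §4 — and the consistency `example`: «SourceCommute»'s route (commute, then Cauchy on `E`) gives the same number as §2;
* §4 **`norm_taylorCoeff_letter_le`**: the `k`-th Taylor term at `|μ| < μ₁′` costs `B·(|μ|∕μ₁′)^k`; **`norm_tBoxMixedLetter_sub_taylor_le`**: THE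
  REMAINDER — `‖(1.23)(E(μ)) − Σ_{k<K} μ^k∕k!·(1.23)(∂^k_μ E(0))‖ ≤ B·(|μ|∕μ₁′)^K∕(1 − |μ|∕μ₁′)` (geometric tail, `hasSum_nat_add_iff'` +
  `tsum_of_norm_bounded`); **`norm_tBoxMixedLetter_sub_zero_le`** (`K = 1`): `‖(1.23)(E(μ)) − (1.23)(E(0))‖ ≤ B·(|μ|∕μ₁′)∕(1 − |μ|∕μ₁′)` — the
  part of the letter generated by the source is LINEAR in `|μ|` near `0`, with the third radius `μ₁′` in the denominator (the SHAPE of the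
  cell's regeneration currencies read at the letter object; nothing of S52∕S55∕S56 imported or restated);
* §5 decided (W98's datum `E = μ²·t·z₀z₁`, `|μ| < 2`, `ρ = 1`, cube radii `3∕2`): the third source derivative of the letter VANISHES at every
  `|μ| < 2` («SourceCommute» §3 at `k = 3`: the letter of the zero field) — the letter `μ²` is its own degree-two Taylor polynomial.

HONEST FRAMING.  [folklore] one-variable Cauchy–Taylor theory (Mathlib) + «SourceCommute»∕W98∕W93∕W89 BY NAME on OUR dictionary objects; a
DICTIONARY row — the SHAPE of a source expansion of a (1.23)∕(2.14)-type term, NOT an estimate of print and NOT a statement about Bałaban's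
densities.  As for «SourceCommute» (owner's rider, t4-ne1p-p1 g41 l.25202, carried): the hypothesis is JOINT analyticity of `E` on
`{|μ| < μ₁} ×ˢ polydisc` with (1.21)∕(2.20)-type sup bounds `A` — for Bałaban's dressed small-field input that datum is exactly the (w1)∕(B2)
birth datum, NEW-UNPRINTED; this file RELOCATES the cell's source expansion (C-t4r2-340 (n1)–(n5)) to that datum and discharges nothing of it;
`A`∕`B`, the radii and the strict sub-window `μ₀ < μ₁′ < μ₁` are HYPOTHESES; Lemma 3 ∕ C₃ ∕ (1.25) untouched; no numeral of [Balaban1988RGII]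
asserted (k2); nothing of print quoted beyond W89's p. 7 loci (TYPE); (B1) for Bałaban's (2.14) NOT discharged; (B3) = GAPS G-ne9p2-5 UNPRINTED
— NOT discharged, untouched; (B5) untouched; (w5)∕(w5b)∕(w6) NOT discharged; 0 binders instantiated on Bałaban's densities ∕ operators ∕ (2.14)
data ∕ `d_k` ∕ minimisers ∕ backgrounds; discharges no wall item; wall v1.8 (T4-DAG v48) does NOT move; R-t4r2-Q2 NOT met thereby; NE1′ ⇐ the
named binders — NOT proved, NOT printed; spine PROVED 0∕9; count 9 unchanged.  Rung (B)+1 on ONE finite four-torus — NOT infinite volume, NOT a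
mass gap, NOT OS on ℝ⁴, NOT Clay.  ABSOLUTE RULE honoured: no locus of print is newly quoted; the referee notes and the owner's rider are CELL
records quoted as such; nothing internally minted is cited as a fact; [folklore] tags on kernel lemmas only.  HONEST DEPENDENCY: continuum YM on
T⁴ ⇐ BetaPertH ∧ nine spine estimates (0/9 proved); BetaPertH ⇐ (D1) ∧ (D4) ∧ CAP+tail; G-an2-4 gates asym, D1 and NE2/3/4.
-/

noncomputable section

namespace Summit.QuantumFields.BalabanUV.T4Continuum.NE1p.DressedSmallFieldTBoxMixedLetterSourceSeries

open MeasureTheory Metric Set Complex Finset Function Filter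
open scoped BigOperators Topology
open Summit.QuantumFields.BalabanUV.T4Continuum.B13TermContours
open Summit.QuantumFields.BalabanUV.T4Continuum.NE1p.DressedSmallFieldMixedLetter
open Summit.QuantumFields.BalabanUV.T4Continuum.NE1p.DressedSmallFieldTBoxMixedLetterLocal (norm_tBoxMixedLetter_le)
open Summit.QuantumFields.BalabanUV.T4Continuum.NE1p.DressedSmallFieldTBoxMixedLetterSpectator (analyticOnNhd_section)
open Summit.QuantumFields.BalabanUV.T4Continuum.NE1p.DressedSmallFieldTBoxMixedLetterThirdRadius
  (differentiableOn_letter_source analyticOnNhd_source_toy)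
open Summit.QuantumFields.BalabanUV.T4Continuum.NE1p.DressedSmallFieldTBoxMixedLetterSourceCommute
open Literature.MathematicalPhysics.QuantumFieldTheory.Dimock2011to13.PolydiscCauchyBounds (polydisc)

variable {n : ℕ}

/-! ## §1 THE TAYLOR SERIES OF THE LETTER IN THE SOURCE: its coefficients are the letters of the Taylor coefficients of the factor -/

/-- **`(1.23)(E(μ)) = Σ_k μ^k∕k! · (1.23)(∂^k E∕∂μ^k(0))` ON THE WHOLE SOURCE DISC** (kernel; Mathlib `Complex.hasSum_taylorSeries_on_ball` for the
holomorphic `μ ↦ (1.23)(E(μ))` (W98 `differentiableOn_letter_source`) + «SourceCommute» `iteratedDeriv_tBoxMixedLetter_source` at `μ = 0`): for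
`E(μ; t_□, σ)` JOINTLY analytic on `{|μ| < μ₁} × {|t| < R₀} × Π_j{|σ_j| < R_{j+1}}`, the `t_□`-radius `0 < ρ < R₀`, contour radii `1 < r_j < R_{j+1}`
and `|μ| < μ₁`, the series `Σ_k (k!)⁻¹ · μ^k · ∫_{θ_□} w₁ ρ (0,θ_□)·(∫ wS r S p·∂^k E∕∂μ^k(0; circ ρ θ_□ ∷ σ_S p) d(⨂ μS S)) dθ_□` converges to
`∫_{θ_□} w₁ ρ (0,θ_□)·(∫ wS r S p·E(μ; circ ρ θ_□ ∷ σ_S p) d(⨂ μS S)) dθ_□` — the source expansion of a (1.23)∕(2.14)-type term, TERM BY TERM of the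
same type (the cell's reading (n1)∕(n2), a CELL record; nothing of print). [folklore] -/
theorem hasSum_tBoxMixedLetter_source {μ₁ ρ : ℝ} (hρ : 0 < ρ) {r : Fin n → ℝ} {R : Fin (n + 1) → ℝ} (hρR : ρ < R 0)
    (hr : ∀ j, 1 < r j) (hrR : ∀ j : Fin n, r j < R j.succ) (S : Finset (Fin n)) {E : ℂ → (Fin (n + 1) → ℂ) → ℂ}
    (hE : AnalyticOnNhd ℂ (fun q : ℂ × (Fin (n + 1) → ℂ) => E q.1 q.2) (ball (0 : ℂ) μ₁ ×ˢ Set.univ.pi fun j => ball (0 : ℂ) (R j)))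
    {μ : ℂ} (hμ : ‖μ‖ < μ₁) :
    HasSum (fun k : ℕ => ((k.factorial : ℕ) : ℂ)⁻¹ • μ ^ k • ∫ θ₀ in Icc 0 (2 * Real.pi), w₁ ρ (0, θ₀) *
        ∫ p, wS r S p * iteratedDeriv k (fun μ' : ℂ => E μ' (Fin.cons (circ ρ θ₀) (σS r S p))) 0 ∂(Measure.pi (μS S)))
      (∫ θ₀ in Icc 0 (2 * Real.pi), w₁ ρ (0, θ₀) * ∫ p, wS r S p * E μ (Fin.cons (circ ρ θ₀) (σS r S p)) ∂(Measure.pi (μS S))) := by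
  have h0 : (0 : ℂ) ∈ ball (0 : ℂ) μ₁ := mem_ball_self (lt_of_le_of_lt (norm_nonneg μ) hμ)
  have hk : ∀ k : ℕ, (∫ θ₀ in Icc 0 (2 * Real.pi), w₁ ρ (0, θ₀) *
      ∫ p, wS r S p * iteratedDeriv k (fun μ' : ℂ => E μ' (Fin.cons (circ ρ θ₀) (σS r S p))) 0 ∂(Measure.pi (μS S))) =
      iteratedDeriv k (fun μ' : ℂ => ∫ θ₀ in Icc 0 (2 * Real.pi), w₁ ρ (0, θ₀) *
        ∫ p, wS r S p * E μ' (Fin.cons (circ ρ θ₀) (σS r S p)) ∂(Measure.pi (μS S))) 0 := fun k =>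
    (iteratedDeriv_tBoxMixedLetter_source isOpen_ball hρ hρR hr hrR S hE k h0).symm
  simp_rw [hk]
  simpa only [sub_zero] using
    Complex.hasSum_taylorSeries_on_ball (differentiableOn_letter_source hρ hρR hr hrR S hE) (mem_ball_zero_iff.2 hμ)

/-- **… as an identity of sums** [folklore]: `(1.23)(E(μ)) = Σ' k, (k!)⁻¹ · μ^k · (1.23)(∂^k E∕∂μ^k(0))` for `|μ| < μ₁`. -/
theorem tBoxMixedLetter_eq_tsum_source {μ₁ ρ : ℝ} (hρ : 0 < ρ) {r : Fin n → ℝ} {R : Fin (n + 1) → ℝ} (hρR : ρ < R 0)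
    (hr : ∀ j, 1 < r j) (hrR : ∀ j : Fin n, r j < R j.succ) (S : Finset (Fin n)) {E : ℂ → (Fin (n + 1) → ℂ) → ℂ}
    (hE : AnalyticOnNhd ℂ (fun q : ℂ × (Fin (n + 1) → ℂ) => E q.1 q.2) (ball (0 : ℂ) μ₁ ×ˢ Set.univ.pi fun j => ball (0 : ℂ) (R j)))
    {μ : ℂ} (hμ : ‖μ‖ < μ₁) :
    (∫ θ₀ in Icc 0 (2 * Real.pi), w₁ ρ (0, θ₀) * ∫ p, wS r S p * E μ (Fin.cons (circ ρ θ₀) (σS r S p)) ∂(Measure.pi (μS S))) =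
      ∑' k : ℕ, ((k.factorial : ℕ) : ℂ)⁻¹ • μ ^ k • ∫ θ₀ in Icc 0 (2 * Real.pi), w₁ ρ (0, θ₀) *
        ∫ p, wS r S p * iteratedDeriv k (fun μ' : ℂ => E μ' (Fin.cons (circ ρ θ₀) (σS r S p))) 0 ∂(Measure.pi (μS S)) :=
  (hasSum_tBoxMixedLetter_source hρ hρR hr hrR S hE hμ).tsum_eq.symm

/-! ## §2 Cauchy's estimate at every order on the strict sub-window -/

/-- **ONE MORE RADIUS, AT ORDER `k`** [folklore] (Mathlib `Complex.norm_iteratedDeriv_le_of_forall_mem_sphere_norm_le` on the circle of radius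
`μ₁′ − μ₀` about `μ`, which stays in `{|z| ≤ μ₁′}` inside the disc of analyticity; W98 §1 `norm_deriv_le_of_strict_window` is `k = 1`): for `f`
holomorphic on `{|z| < μ₁}`, `‖f‖ ≤ B` on `{|z| ≤ μ₁′}`, `μ₀ < μ₁′ < μ₁`, `|μ| ≤ μ₀`: `‖f^{(k)}(μ)‖ ≤ k!·B∕(μ₁′ − μ₀)^k`. -/
theorem norm_iteratedDeriv_le_of_strict_window {f : ℂ → ℂ} {μ₁ μ₁' μ₀ B : ℝ} (h01 : μ₀ < μ₁') (h1 : μ₁' < μ₁)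
    (hf : DifferentiableOn ℂ f (ball (0 : ℂ) μ₁)) (hB : ∀ z ∈ closedBall (0 : ℂ) μ₁', ‖f z‖ ≤ B) (k : ℕ) {μ : ℂ} (hμ : ‖μ‖ ≤ μ₀) :
    ‖iteratedDeriv k f μ‖ ≤ k.factorial * B / (μ₁' - μ₀) ^ k := by
  have hR : 0 < μ₁' - μ₀ := sub_pos.2 h01
  have hsub : closedBall μ (μ₁' - μ₀) ⊆ closedBall (0 : ℂ) μ₁' := fun z hz => by
    rw [mem_closedBall, dist_zero_right]
    have h := mem_closedBall.1 hz
    rw [dist_eq_norm] at h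
    calc ‖z‖ = ‖(z - μ) + μ‖ := by rw [sub_add_cancel]
      _ ≤ ‖z - μ‖ + ‖μ‖ := norm_add_le _ _
      _ ≤ (μ₁' - μ₀) + μ₀ := add_le_add h hμ
      _ = μ₁' := by ring
  have hsubU : closedBall μ (μ₁' - μ₀) ⊆ ball (0 : ℂ) μ₁ := hsub.trans (closedBall_subset_ball h1)
  exact Complex.norm_iteratedDeriv_le_of_forall_mem_sphere_norm_le k hR (hf.diffContOnCl_ball hsubU)
    fun z hz => hB z (hsub (sphere_subset_closedBall hz))

/-- **CAUCHY AT ORDER `k` ON THE LETTER** [folklore] (§2 on the holomorphic letter — W98 `differentiableOn_letter_source` — with W89's circle bound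
`norm_tBoxMixedLetter_le` on every section over `{|μ′| ≤ μ₁′}`, W93 `analyticOnNhd_section`): under `κ₁ ≥ 1`, `R_{j+1} > e^{κ₁}`, a bound
`‖E(μ′; t ∷ z)‖ ≤ A` for `|μ′| ≤ μ₁′`, `|t| = ρ`, `|z_j| ≤ e^{κ₁}` (HYPOTHESIS of (1.21)-TYPE) and the strict sub-window `μ₀ < μ₁′ < μ₁`: for `|μ| ≤ μ₀`,
`‖∂^k∕∂μ^k (1.23)(E(·))(μ)‖ ≤ k! · ρ⁻¹·(A·e^{−(κ₁−1)·#S}) ∕ (μ₁′ − μ₀)^k` — W98 §3 is `k = 1`. -/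
theorem norm_iteratedDeriv_letter_source_le {μ₁ μ₁' μ₀ ρ : ℝ} (h01 : μ₀ < μ₁') (h1 : μ₁' < μ₁) (hρ : 0 < ρ) {r : Fin n → ℝ}
    {R : Fin (n + 1) → ℝ} (hρR : ρ < R 0) (hr : ∀ j, 1 < r j) (hrR : ∀ j : Fin n, r j < R j.succ) {κ₁ A : ℝ} (hκ : 1 ≤ κ₁)
    (hRκ : ∀ j : Fin n, Real.exp κ₁ < R j.succ) (S : Finset (Fin n)) {E : ℂ → (Fin (n + 1) → ℂ) → ℂ}
    (hE : AnalyticOnNhd ℂ (fun q : ℂ × (Fin (n + 1) → ℂ) => E q.1 q.2) (ball (0 : ℂ) μ₁ ×ˢ Set.univ.pi fun j => ball (0 : ℂ) (R j)))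
    (hA : ∀ μ' ∈ closedBall (0 : ℂ) μ₁', ∀ t : ℂ, ‖t‖ = ρ → ∀ z ∈ polydisc (fun _ : Fin n => Real.exp κ₁), ‖E μ' (Fin.cons t z)‖ ≤ A)
    (k : ℕ) {μ : ℂ} (hμ : ‖μ‖ ≤ μ₀) :
    ‖iteratedDeriv k (fun μ' : ℂ => ∫ θ₀ in Icc 0 (2 * Real.pi), w₁ ρ (0, θ₀) *
        ∫ p, wS r S p * E μ' (Fin.cons (circ ρ θ₀) (σS r S p)) ∂(Measure.pi (μS S))) μ‖ ≤
      k.factorial * (ρ⁻¹ * (A * Real.exp (-((κ₁ - 1) * S.card)))) / (μ₁' - μ₀) ^ k :=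
  norm_iteratedDeriv_le_of_strict_window h01 h1 (differentiableOn_letter_source hρ hρR hr hrR S hE)
    (fun μ' hμ' => norm_tBoxMixedLetter_le hρ hρR hr hrR hκ hRκ S (analyticOnNhd_section hE (closedBall_subset_ball h1 hμ')) (hA μ' hμ'))
    k hμ

/-! ## §3 Cauchy at order `k` on the FACTOR: the currency `A_k` of «SourceCommute» §4; the two routes agree -/

/-- **`‖∂^k E∕∂μ^k(μ; v)‖ ≤ k!·A∕(μ₁′ − μ₀)^k`** [folklore] (§2 on the slice `μ′ ↦ E(μ′; v)`, holomorphic on `{|μ′| < μ₁}` for `v` in the polydisc):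
the (1.21)-type bound `A` on `E` over `{|μ′| ≤ μ₁′}` supplies «SourceCommute»'s currency `A_k` on `|μ| ≤ μ₀ < μ₁′ < μ₁`. -/
theorem norm_iteratedDeriv_source_le_of_strict_window {μ₁ μ₁' μ₀ : ℝ} (h01 : μ₀ < μ₁') (h1 : μ₁' < μ₁) {R : Fin (n + 1) → ℝ}
    {E : ℂ → (Fin (n + 1) → ℂ) → ℂ}
    (hE : AnalyticOnNhd ℂ (fun q : ℂ × (Fin (n + 1) → ℂ) => E q.1 q.2) (ball (0 : ℂ) μ₁ ×ˢ Set.univ.pi fun j => ball (0 : ℂ) (R j)))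
    {v : Fin (n + 1) → ℂ} (hv : v ∈ Set.univ.pi fun j => ball (0 : ℂ) (R j)) {A : ℝ} (hA : ∀ μ' ∈ closedBall (0 : ℂ) μ₁', ‖E μ' v‖ ≤ A)
    (k : ℕ) {μ : ℂ} (hμ : ‖μ‖ ≤ μ₀) :
    ‖iteratedDeriv k (fun μ' : ℂ => E μ' v) μ‖ ≤ k.factorial * A / (μ₁' - μ₀) ^ k :=
  norm_iteratedDeriv_le_of_strict_window h01 h1
    ((hE.comp (analyticOnNhd_id.prod analyticOnNhd_const) fun _ hμ' => ⟨hμ', hv⟩).differentiableOn) hA k hμ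

/-- CONSISTENCY CHECK at order `k` (the two routes agree, BOTH BY NAME): (i) §2 `norm_iteratedDeriv_letter_source_le` (Cauchy on the LETTER); (ii)
«SourceCommute» §4 `norm_iteratedDeriv_tBoxMixedLetter_source_le` with `A_k := k!·A∕(μ₁′ − μ₀)^k` from §3 (commute, then Cauchy on the FACTOR);
(iii) the two numbers are equal. -/
example {μ₁ μ₁' μ₀ ρ : ℝ} (h01 : μ₀ < μ₁') (h1 : μ₁' < μ₁) (hρ : 0 < ρ) {r : Fin n → ℝ} {R : Fin (n + 1) → ℝ} (hρR : ρ < R 0)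
    (hr : ∀ j, 1 < r j) (hrR : ∀ j : Fin n, r j < R j.succ) {κ₁ A : ℝ} (hκ : 1 ≤ κ₁) (hRκ : ∀ j : Fin n, Real.exp κ₁ < R j.succ)
    (S : Finset (Fin n)) {E : ℂ → (Fin (n + 1) → ℂ) → ℂ}
    (hE : AnalyticOnNhd ℂ (fun q : ℂ × (Fin (n + 1) → ℂ) => E q.1 q.2) (ball (0 : ℂ) μ₁ ×ˢ Set.univ.pi fun j => ball (0 : ℂ) (R j)))
    (hA : ∀ μ' ∈ closedBall (0 : ℂ) μ₁', ∀ t : ℂ, ‖t‖ = ρ → ∀ z ∈ polydisc (fun _ : Fin n => Real.exp κ₁), ‖E μ' (Fin.cons t z)‖ ≤ A)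
    (k : ℕ) {μ : ℂ} (hμ : ‖μ‖ ≤ μ₀) :
    ‖iteratedDeriv k (fun μ' : ℂ => ∫ θ₀ in Icc 0 (2 * Real.pi), w₁ ρ (0, θ₀) *
        ∫ p, wS r S p * E μ' (Fin.cons (circ ρ θ₀) (σS r S p)) ∂(Measure.pi (μS S))) μ‖ ≤
      k.factorial * (ρ⁻¹ * (A * Real.exp (-((κ₁ - 1) * S.card)))) / (μ₁' - μ₀) ^ k ∧
    ‖iteratedDeriv k (fun μ' : ℂ => ∫ θ₀ in Icc 0 (2 * Real.pi), w₁ ρ (0, θ₀) *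
        ∫ p, wS r S p * E μ' (Fin.cons (circ ρ θ₀) (σS r S p)) ∂(Measure.pi (μS S))) μ‖ ≤
      ρ⁻¹ * (k.factorial * A / (μ₁' - μ₀) ^ k * Real.exp (-((κ₁ - 1) * S.card))) ∧
    ρ⁻¹ * (k.factorial * A / (μ₁' - μ₀) ^ k * Real.exp (-((κ₁ - 1) * S.card))) =
      k.factorial * (ρ⁻¹ * (A * Real.exp (-((κ₁ - 1) * S.card)))) / (μ₁' - μ₀) ^ k := by
  have hμW : μ ∈ ball (0 : ℂ) μ₁ := mem_ball_zero_iff.2 (lt_of_le_of_lt hμ (h01.trans h1))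
  refine ⟨norm_iteratedDeriv_letter_source_le h01 h1 hρ hρR hr hrR hκ hRκ S hE hA k hμ, ?_, by ring⟩
  exact norm_iteratedDeriv_tBoxMixedLetter_source_le isOpen_ball hρ hρR hr hrR hκ hRκ S hE k hμW
    (Ak := k.factorial * A / (μ₁' - μ₀) ^ k)
    fun t ht z hz => norm_iteratedDeriv_source_le_of_strict_window h01 h1 hE (cons_mem_polyBall hρR hRκ ht hz)
      (fun μ' hμ' => hA μ' hμ' t ht z hz) k hμ

/-! ## §4 THE TAYLOR REMAINDER IN THE SOURCE -/

/-- **THE `k`-TH TAYLOR TERM COSTS `B·(|μ|∕μ₁′)^k`** [folklore] (§2 at the centre `μ = 0` with the window `0 < μ₁′ < μ₁`: `‖∂^k_μ (1.23)(0)‖ ≤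
k!·B∕μ₁′^k`, `B = ρ⁻¹·A·e^{−(κ₁−1)·#S}`; then `‖(k!)⁻¹·μ^k·c‖ = (k!)⁻¹·|μ|^k·‖c‖`): for `|μ′| ≤ μ₁′`-bounds `A` on `E` as in §2 and any source `μ`,
`‖(k!)⁻¹ • μ^k • (1.23)(∂^k_μ E(0))‖ ≤ B · (|μ|∕μ₁′)^k`. -/
theorem norm_taylorCoeff_letter_le {μ₁ μ₁' ρ : ℝ} (h1' : 0 < μ₁') (h1 : μ₁' < μ₁) (hρ : 0 < ρ) {r : Fin n → ℝ}
    {R : Fin (n + 1) → ℝ} (hρR : ρ < R 0) (hr : ∀ j, 1 < r j) (hrR : ∀ j : Fin n, r j < R j.succ) {κ₁ A : ℝ} (hκ : 1 ≤ κ₁)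
    (hRκ : ∀ j : Fin n, Real.exp κ₁ < R j.succ) (S : Finset (Fin n)) {E : ℂ → (Fin (n + 1) → ℂ) → ℂ}
    (hE : AnalyticOnNhd ℂ (fun q : ℂ × (Fin (n + 1) → ℂ) => E q.1 q.2) (ball (0 : ℂ) μ₁ ×ˢ Set.univ.pi fun j => ball (0 : ℂ) (R j)))
    (hA : ∀ μ' ∈ closedBall (0 : ℂ) μ₁', ∀ t : ℂ, ‖t‖ = ρ → ∀ z ∈ polydisc (fun _ : Fin n => Real.exp κ₁), ‖E μ' (Fin.cons t z)‖ ≤ A)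
    (k : ℕ) (μ : ℂ) :
    ‖((k.factorial : ℕ) : ℂ)⁻¹ • μ ^ k • ∫ θ₀ in Icc 0 (2 * Real.pi), w₁ ρ (0, θ₀) *
        ∫ p, wS r S p * iteratedDeriv k (fun μ' : ℂ => E μ' (Fin.cons (circ ρ θ₀) (σS r S p))) 0 ∂(Measure.pi (μS S))‖ ≤
      ρ⁻¹ * (A * Real.exp (-((κ₁ - 1) * S.card))) * (‖μ‖ / μ₁') ^ k := by
  have h0 : (0 : ℂ) ∈ ball (0 : ℂ) μ₁ := mem_ball_self (h1'.trans h1)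
  -- the coefficient is the `k`-th source derivative of the letter at `0`, bounded by Cauchy on the window `0 < μ₁′ < μ₁`
  have hc : ‖∫ θ₀ in Icc 0 (2 * Real.pi), w₁ ρ (0, θ₀) *
      ∫ p, wS r S p * iteratedDeriv k (fun μ' : ℂ => E μ' (Fin.cons (circ ρ θ₀) (σS r S p))) 0 ∂(Measure.pi (μS S))‖ ≤
      k.factorial * (ρ⁻¹ * (A * Real.exp (-((κ₁ - 1) * S.card)))) / μ₁' ^ k := by
    rw [← iteratedDeriv_tBoxMixedLetter_source isOpen_ball hρ hρR hr hrR S hE k h0]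
    simpa only [sub_zero] using norm_iteratedDeriv_letter_source_le h1' h1 hρ hρR hr hrR hκ hRκ S hE hA k (μ := 0) (by simp)
  have hfac : (0 : ℝ) < k.factorial := by exact_mod_cast k.factorial_pos
  have hB : 0 ≤ ρ⁻¹ * (A * Real.exp (-((κ₁ - 1) * S.card))) := by
    have hA0 : 0 ≤ A := le_trans (norm_nonneg _) (hA 0 (mem_closedBall_self h1'.le) (circ ρ 0) (norm_circ hρ.le 0) 0
      (fun _ => by simpa using (Real.exp_pos κ₁).le))
    positivity
  rw [norm_smul, norm_smul, norm_inv, Complex.norm_natCast, norm_pow]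
  calc (k.factorial : ℝ)⁻¹ * (‖μ‖ ^ k * ‖∫ θ₀ in Icc 0 (2 * Real.pi), w₁ ρ (0, θ₀) *
        ∫ p, wS r S p * iteratedDeriv k (fun μ' : ℂ => E μ' (Fin.cons (circ ρ θ₀) (σS r S p))) 0 ∂(Measure.pi (μS S))‖)
      ≤ (k.factorial : ℝ)⁻¹ * (‖μ‖ ^ k * (k.factorial * (ρ⁻¹ * (A * Real.exp (-((κ₁ - 1) * S.card)))) / μ₁' ^ k)) := by
        gcongr
    _ = ρ⁻¹ * (A * Real.exp (-((κ₁ - 1) * S.card))) * (‖μ‖ / μ₁') ^ k := by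
        rw [div_pow]; field_simp

/-- **THE TAYLOR REMAINDER OF THE LETTER IN THE SOURCE** (kernel; §1's `HasSum` shifted by `K` terms — Mathlib `hasSum_nat_add_iff'` — and the
geometric majorant `Σ_k B·(|μ|∕μ₁′)^{k+K}` of §4's coefficient bound, `hasSum_geometric_of_lt_one` + `tsum_of_norm_bounded`): for `E` jointly
analytic on `{|μ| < μ₁} × polydisc`, `κ₁ ≥ 1`, `R_{j+1} > e^{κ₁}`, `0 < ρ < R₀`, `1 < r_j < R_{j+1}`, a (1.21)-type bound `A` on `{|μ′| ≤ μ₁′} ×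
{|t| = ρ} × {|z_j| ≤ e^{κ₁}}` with `0 < μ₁′ < μ₁`, every `K` and every source `|μ| < μ₁′`:
`‖(1.23)(E(μ)) − Σ_{k<K} (k!)⁻¹·μ^k·(1.23)(∂^k_μ E(0))‖ ≤ ρ⁻¹·(A·e^{−(κ₁−1)·#S}) · (|μ|∕μ₁′)^K ∕ (1 − |μ|∕μ₁′)` — the source expansion of a
(1.23)∕(2.14)-type term truncated at order `K` (the SHAPE of the cell's (w5b)-type bookkeeping at the letter object; a reading, nothing
of print; the third radius `μ₁′` is DISPLAYED). [folklore] -/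
theorem norm_tBoxMixedLetter_sub_taylor_le {μ₁ μ₁' ρ : ℝ} (h1' : 0 < μ₁') (h1 : μ₁' < μ₁) (hρ : 0 < ρ) {r : Fin n → ℝ}
    {R : Fin (n + 1) → ℝ} (hρR : ρ < R 0) (hr : ∀ j, 1 < r j) (hrR : ∀ j : Fin n, r j < R j.succ) {κ₁ A : ℝ} (hκ : 1 ≤ κ₁)
    (hRκ : ∀ j : Fin n, Real.exp κ₁ < R j.succ) (S : Finset (Fin n)) {E : ℂ → (Fin (n + 1) → ℂ) → ℂ}
    (hE : AnalyticOnNhd ℂ (fun q : ℂ × (Fin (n + 1) → ℂ) => E q.1 q.2) (ball (0 : ℂ) μ₁ ×ˢ Set.univ.pi fun j => ball (0 : ℂ) (R j)))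
    (hA : ∀ μ' ∈ closedBall (0 : ℂ) μ₁', ∀ t : ℂ, ‖t‖ = ρ → ∀ z ∈ polydisc (fun _ : Fin n => Real.exp κ₁), ‖E μ' (Fin.cons t z)‖ ≤ A)
    (K : ℕ) {μ : ℂ} (hμ : ‖μ‖ < μ₁') :
    ‖(∫ θ₀ in Icc 0 (2 * Real.pi), w₁ ρ (0, θ₀) * ∫ p, wS r S p * E μ (Fin.cons (circ ρ θ₀) (σS r S p)) ∂(Measure.pi (μS S))) -
        ∑ k ∈ Finset.range K, ((k.factorial : ℕ) : ℂ)⁻¹ • μ ^ k • ∫ θ₀ in Icc 0 (2 * Real.pi), w₁ ρ (0, θ₀) *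
          ∫ p, wS r S p * iteratedDeriv k (fun μ' : ℂ => E μ' (Fin.cons (circ ρ θ₀) (σS r S p))) 0 ∂(Measure.pi (μS S))‖ ≤
      ρ⁻¹ * (A * Real.exp (-((κ₁ - 1) * S.card))) * (‖μ‖ / μ₁') ^ K / (1 - ‖μ‖ / μ₁') := by
  set B : ℝ := ρ⁻¹ * (A * Real.exp (-((κ₁ - 1) * S.card))) with hBdef
  have hq0 : 0 ≤ ‖μ‖ / μ₁' := div_nonneg (norm_nonneg _) h1'.le
  have hq1 : ‖μ‖ / μ₁' < 1 := (div_lt_one h1').2 hμ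
  -- the tail of the Taylor series sums to the remainder
  have htail := (hasSum_nat_add_iff' K).2 (hasSum_tBoxMixedLetter_source hρ hρR hr hrR S hE (hμ.trans h1))
  rw [← htail.tsum_eq]
  -- geometric majorant of the tail
  have hgeom : HasSum (fun k : ℕ => B * (‖μ‖ / μ₁') ^ K * (‖μ‖ / μ₁') ^ k) (B * (‖μ‖ / μ₁') ^ K * (1 - ‖μ‖ / μ₁')⁻¹) :=
    (hasSum_geometric_of_lt_one hq0 hq1).mul_left _
  rw [div_eq_mul_inv]
  refine tsum_of_norm_bounded hgeom fun k => ?_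
  calc _ ≤ B * (‖μ‖ / μ₁') ^ (k + K) := norm_taylorCoeff_letter_le h1' h1 hρ hρR hr hrR hκ hRκ S hE hA (k + K) μ
    _ = B * (‖μ‖ / μ₁') ^ K * (‖μ‖ / μ₁') ^ k := by ring

/-- **`K = 1`: THE PART OF THE LETTER GENERATED BY THE SOURCE IS LINEAR IN `|μ|`** [folklore] (the previous theorem at `K = 1`; the zeroth Taylor
term is the letter at `μ = 0`): for `|μ| < μ₁′`,
`‖(1.23)(E(μ)) − (1.23)(E(0))‖ ≤ ρ⁻¹·(A·e^{−(κ₁−1)·#S}) · (|μ|∕μ₁′) ∕ (1 − |μ|∕μ₁′)` — the SHAPE of the cell's regeneration currencies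
(S52∕S55's «`M·σ∕(ε − σ)`» form) read at the letter object, with the third radius `μ₁′` in the denominator; nothing of theirs imported or
restated; (w5) NOT discharged. -/
theorem norm_tBoxMixedLetter_sub_zero_le {μ₁ μ₁' ρ : ℝ} (h1' : 0 < μ₁') (h1 : μ₁' < μ₁) (hρ : 0 < ρ) {r : Fin n → ℝ}
    {R : Fin (n + 1) → ℝ} (hρR : ρ < R 0) (hr : ∀ j, 1 < r j) (hrR : ∀ j : Fin n, r j < R j.succ) {κ₁ A : ℝ} (hκ : 1 ≤ κ₁)
    (hRκ : ∀ j : Fin n, Real.exp κ₁ < R j.succ) (S : Finset (Fin n)) {E : ℂ → (Fin (n + 1) → ℂ) → ℂ}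
    (hE : AnalyticOnNhd ℂ (fun q : ℂ × (Fin (n + 1) → ℂ) => E q.1 q.2) (ball (0 : ℂ) μ₁ ×ˢ Set.univ.pi fun j => ball (0 : ℂ) (R j)))
    (hA : ∀ μ' ∈ closedBall (0 : ℂ) μ₁', ∀ t : ℂ, ‖t‖ = ρ → ∀ z ∈ polydisc (fun _ : Fin n => Real.exp κ₁), ‖E μ' (Fin.cons t z)‖ ≤ A)
    {μ : ℂ} (hμ : ‖μ‖ < μ₁') :
    ‖(∫ θ₀ in Icc 0 (2 * Real.pi), w₁ ρ (0, θ₀) * ∫ p, wS r S p * E μ (Fin.cons (circ ρ θ₀) (σS r S p)) ∂(Measure.pi (μS S))) -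
        ∫ θ₀ in Icc 0 (2 * Real.pi), w₁ ρ (0, θ₀) * ∫ p, wS r S p * E 0 (Fin.cons (circ ρ θ₀) (σS r S p)) ∂(Measure.pi (μS S))‖ ≤
      ρ⁻¹ * (A * Real.exp (-((κ₁ - 1) * S.card))) * (‖μ‖ / μ₁') / (1 - ‖μ‖ / μ₁') := by
  simpa [Finset.sum_range_one, iteratedDeriv_zero] using
    norm_tBoxMixedLetter_sub_taylor_le h1' h1 hρ hρR hr hrR hκ hRκ S hE hA 1 hμ

/-! ## §5 Decided check: the letter of W98's datum is its own degree-two Taylor polynomial -/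

/-- DECIDED CHECK (W98's datum `E(μ; t, z₀, z₁) = μ²·t·z₀z₁`, source disc `|μ| < 2`, `t_□`-radius `1 < 2`, cube radii `3∕2 < 2`): at every `|μ| < 2`
the THIRD source derivative of the letter vanishes — «SourceCommute» §3 at `k = 3` turns it into the letter of `∂³_μ E = 0`, the letter of the
zero field (the letter is `μ²`: degree two in the source). -/
example {μ : ℂ} (hμ : ‖μ‖ < 2) : iteratedDeriv 3 (fun μ' : ℂ => ∫ θ₀ in Icc 0 (2 * Real.pi), w₁ 1 (0, θ₀) *
    ∫ p : Fin 2 → ℝ × ℝ, wS (fun _ => (3 / 2 : ℝ)) {0, 1} p *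
      (μ' ^ 2 * circ 1 θ₀ * (σS (fun _ => (3 / 2 : ℝ)) {0, 1} p 0 * σS (fun _ => (3 / 2 : ℝ)) {0, 1} p 1)) ∂(Measure.pi (μS {0, 1})))
    μ = 0 := by
  have h := iteratedDeriv_tBoxMixedLetter_source (n := 2) (W := ball (0 : ℂ) 2) isOpen_ball (ρ := 1) one_pos (r := fun _ => 3 / 2)
    (R := fun _ => 2) (by norm_num) (fun _ => by norm_num) (fun _ => by norm_num) {0, 1}
    (E := fun u v => u ^ 2 * v 0 * (v (Fin.succ 0) * v (Fin.succ 1))) (analyticOnNhd_source_toy _ _) 3 (mem_ball_zero_iff.2 hμ)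
  simp only [Fin.cons_zero, Fin.cons_succ] at h
  rw [h]
  -- the third source derivative of the factor vanishes: `∂³_μ (μ²·a·b) = 0`
  have hd3 : ∀ a b : ℂ, iteratedDeriv 3 (fun μ' : ℂ => μ' ^ 2 * a * b) μ = 0 := fun a b => by
    have h1 : deriv (fun μ' : ℂ => μ' ^ 2 * a * b) = fun μ' => 2 * μ' * (a * b) := by
      funext x
      rw [(((hasDerivAt_pow 2 x).mul_const a).mul_const b).deriv]
      push_cast
      ring
    have h2 : deriv (fun μ' : ℂ => 2 * μ' * (a * b)) = fun _ => 2 * (a * b) := by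
      funext x
      rw [(((hasDerivAt_id' x).const_mul (2 : ℂ)).mul_const (a * b)).deriv]
      ring
    rw [iteratedDeriv_succ, iteratedDeriv_succ, iteratedDeriv_one, h1, h2, deriv_const]
  simp_rw [hd3]
  simp

end Summit.QuantumFields.BalabanUV.T4Continuum.NE1p.DressedSmallFieldTBoxMixedLetterSourceSeries

end
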